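import Summits.NavierStokesRegularity.FunctionalMining.QuadraticBudgetRefutation
import Summits.NavierStokesRegularity.FunctionalMining.Sieves
import HarnessLib

/-!
# Functional mining, NO-GO #2b: no monomial enstrophy budget `K^a ℰ^b D^e` of subcritical degree

Search for candidate a priori estimates; no regularity claim.

Cell `pub-nsfunc` (host summit NavierStokesRegularity, topic `FunctionalMining`), NO-GO branch.
`QuadraticBudgetRefutation.lean` closed census row C1 (`dℰ/dt ≤ (C/ν) ℰ²`, every `C`). The same
planted concentrating family closes the whole MONOMIAL class of Sieve 1 (`Sieves.lean`) for the
enstrophy, in the gauges `K = ½‖u‖₂²` (kinetic energy), `ℰ = ½‖∇u‖₂²`, `D = ∫‖Δu‖²`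
(Navier–Stokes scaling degrees `−1, 1, 3`): for ALL real exponents `a, b, e` with

  `b − a + 3e < 3 = s_ℰ + 2`

and EVERY viscosity-dependent constant `C(ν)`, the candidate
`dℰ/dt ≤ C(ν) K^a ℰ^b D^e along every zero-mean classical solution of unforced Navier–Stokes on T³`
is FALSE (`not_isRateBudget_torusEnstrophy_monomial`; in particular every `K^a ℰ^b` with
`b − a < 3`, `not_isRateBudget_torusEnstrophy_monomial_KE`, and row C1 = `(a, b, e) = (0, 2, 0)`).
Proof: along the datum `t₀ • w_n` (`w_n` the planted bump at scale `c = 8n`, amplitude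
`t₀ = (D(U) + 1)/σ(U)` fixed) the initial rate is `t₀² c³` while the budget is `M c^{b−a+3e}` for a
constant `M`; `exponent_le_of_forall_nat_mul_rpow_le` (`Sieves.lean`) forces `3 ≤ b − a + 3e`.
This is Cor. "located gap of the monomial class" (i) of the cell's `estimates.tex`, kernel-checked:
the Lu–Doering law `ℰ³` (`(0,3,0)`, degree `3`) and the interpolation bound `ℰ^{3/4}P^{3/4}`
(`(0, 3/4, 3/4)`, degree `3`) sit exactly on the boundary; nothing of lower degree survives,
whatever the amplitude exponents. No definitions.
-/

noncomputable section

open MeasureTheory Set Filter Topology InnerProductSpace Metric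
open scoped RealInnerProductSpace Laplacian ContDiff

namespace Summit.NavierStokesRegularity.FunctionalMining

open Literature.Analysis.FunctionSpaces Literature.Analysis.FluidPDE

variable {d : Type*} [Fintype d] [DecidableEq d]

/-! ## The kinetic energy along amplitude rays, under planting and concentration -/

omit [DecidableEq d] in
/-- `K(t v) = t² K(v)`. [folklore] -/
theorem kineticEnergy_const_smul (v : UnitAddTorus d → EuclideanSpace ℝ d) (t : ℝ) :
    Torus.kineticEnergy (t • v) = t ^ 2 * Torus.kineticEnergy v := by
  have h : (∫ x, ‖(t • v) x‖ ^ 2) = t ^ 2 * ∫ x, ‖v x‖ ^ 2 := by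
    rw [← integral_const_mul]
    refine integral_congr_ae (ae_of_all _ fun x => ?_)
    simp only [Pi.smul_apply, norm_smul, mul_pow, Real.norm_eq_abs, sq_abs]
  unfold Torus.kineticEnergy
  rw [h]
  ring

/-- **The initial rate along an amplitude ray is bounded by the budget.** If `ℰ` obeys a rate
budget `B` along every zero-mean classical solution on `T³`, then at every smooth divergence-free
zero-mean `w` and every real `t`: `t³ σ(w) − t² D(w) ≤ B 1 (t • w)` (dynamic reduction at the
datum `t • w`, `ν = 1`). [folklore] -/
theorem rate_ray_le_budget {B : ℝ → (UnitAddTorus d → EuclideanSpace ℝ d) → ℝ}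
    (hB : IsRateBudget (d := d) torusEnstrophy B) (hd : Fintype.card d = 3)
    {w : UnitAddTorus d → EuclideanSpace ℝ d} (hw : Torus.IsSmooth w) (hdiv : Torus.IsDivFree w)
    (hmean : Torus.HasZeroMean w) (t : ℝ) :
    t ^ 3 * enstrophyProduction w - t ^ 2 * (∫ x, ‖Torus.laplacian w x‖ ^ 2) ≤ B 1 (t • w) := by
  have hw1 : Torus.IsContDiff 1 w := hw.isContDiff (by exact_mod_cast le_top)
  have h := initialRate_le_of_isRateBudget hB torusEnstrophy_hasInitialRate hd one_pos
    (hw.smul t) (isDivFree_const_smul hw1 hdiv t) (hasZeroMean_const_smul hmean t)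
  rw [enstrophyProduction_const_smul hw t, one_mul, laplacianNormSq_const_smul hw t] at h
  linarith

/-- Concentration scales the `L²` mass like `c⁻¹`: `∫‖c U(c(·+a))‖² = c⁻¹ ∫‖U‖²` on `ℝ³`.
[folklore] -/
theorem normSq_plant (U : EuclideanSpace ℝ (Fin 3) → EuclideanSpace ℝ (Fin 3)) {c : ℝ}
    (hc : 0 < c) (a : EuclideanSpace ℝ (Fin 3)) :
    (∫ y, ‖c • U (c • (y + a))‖ ^ 2) = c⁻¹ * ∫ z, ‖U z‖ ^ 2 := by
  have hpt : ∀ y : EuclideanSpace ℝ (Fin 3), ‖c • U (c • (y + a))‖ ^ 2 =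
      c ^ 2 * (fun z => ‖U z‖ ^ 2) (c • (y + a)) := fun y => by
    rw [norm_smul, mul_pow, Real.norm_eq_abs, sq_abs]
  rw [integral_congr_ae (ae_of_all _ hpt), integral_const_mul,
    integral_comp_plant (fun z => ‖U z‖ ^ 2) hc a, ← mul_assoc]
  congr 1
  field_simp

/-- **Planting: kinetic energy.** `K(periodize g) = ½ ∫_{ℝ³} ‖g‖²` for `g` supported in the open
unit cube. [folklore] -/
theorem kineticEnergy_periodize {g : EuclideanSpace ℝ (Fin 3) → EuclideanSpace ℝ (Fin 3)}
    (hgs : tsupport g ⊆ {y | ∀ i, y i ∈ Ioo (0 : ℝ) 1}) :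
    Torus.kineticEnergy (Torus.periodize g) = 2⁻¹ * ∫ y, ‖g y‖ ^ 2 := by
  obtain ⟨h0, -, -⟩ := eq_zero_off_cube hgs
  unfold Torus.kineticEnergy
  congr 1
  refine Torus.integral_eq_integral_of_forall_proj_eq (fun y hy => ?_) fun y hy => ?_
  · rw [Torus.periodize_proj, Torus.perSum_eq_self_of_mem_unitCube h0 hy]
  · have hy' : ¬ ∀ i, y i ∈ Ioo (0 : ℝ) 1 := fun h => hy fun i => Ioo_subset_Ico_self (h i)
    simp [h0 y hy']

/-- Kinetic energy of the planted family member at scale `c ≥ 8`: `½ c⁻¹ ∫‖U‖²`. [folklore] -/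
theorem planted_kineticEnergy {U : EuclideanSpace ℝ (Fin 3) → EuclideanSpace ℝ (Fin 3)}
    (hUs : tsupport U ⊆ Metric.closedBall 0 2) {q : EuclideanSpace ℝ (Fin 3)}
    (hq : ∀ i, q i = 1 / 2) {c : ℝ} (hc : 8 ≤ c) :
    Torus.kineticEnergy (Torus.periodize fun y => c • U (c • (y + -q))) =
      2⁻¹ * (c⁻¹ * ∫ z, ‖U z‖ ^ 2) := by
  have hc0 : 0 < c := by linarith
  have hgs : tsupport (fun y => c • U (c • (y + -q))) ⊆ {y | ∀ i, y i ∈ Ioo (0 : ℝ) 1} := by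
    intro y hy
    have h1 := tsupport_plant hc0 hUs (-q) hy
    rw [neg_neg, Metric.mem_closedBall, dist_eq_norm] at h1
    have h2 : ‖y - q‖ < 1 / 2 := by
      have : 2 / c ≤ 1 / 4 := by
        rw [div_le_iff₀ hc0]; linarith
      linarith
    simpa using (Torus.add_mem_unitCube_of_norm_lt hq h2).2
  rw [kineticEnergy_periodize hgs, normSq_plant U hc0 (-q)]

/-! ## The monomial class -/

/-- **NO-GO #2b (Sieve 1 for the enstrophy, monomial class, kernel-checked).** For all real
exponents `a, b, e` with `b − a + 3e < 3` and every viscosity-dependent constant `C(ν)`, the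
candidate budget `dℰ/dt ≤ C(ν) · K^a · ℰ^b · D^e` (`K = ½‖u‖₂²`, `ℰ = ½‖∇u‖₂²`, `D = ∫‖Δu‖²`,
real powers `Real.rpow`) FAILS along some zero-mean classical solution of unforced Navier–Stokes
on the unit 3-torus. Proof: plant the whole-space seed `U` (`σ(U) > 0`) at scales `c = 8n` and
run the amplitude ray at `t₀ = (D(U)+1)/σ(U)`: the initial rate is `t₀² c³`, the budget is
`M c^{b−a+3e}` with `M` independent of `n`, and `exponent_le_of_forall_nat_mul_rpow_le`
(`Sieves.lean`) gives `3 ≤ b − a + 3e`. Search for candidate a priori estimates; no regularity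
claim — a negative result about a CLASS of candidate inequalities. [folklore] -/
theorem not_isRateBudget_torusEnstrophy_monomial (a b e : ℝ) (habe : b - a + 3 * e < 3)
    (Cν : ℝ → ℝ) :
    ¬ IsRateBudget (d := Fin 3) torusEnstrophy (fun ν v =>
      Cν ν * Torus.kineticEnergy v ^ a * torusEnstrophy v ^ b *
        (∫ x, ‖Torus.laplacian v x‖ ^ 2) ^ e) := by
  intro hB
  obtain ⟨U, hU, hUs, hdiv, hσ⟩ := BumpWitness.exists_compactSupport_divFree_production_pos
  obtain ⟨q, hq⟩ : ∃ q : EuclideanSpace ℝ (Fin 3), ∀ i, q i = 1 / 2 :=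
    ⟨WithLp.toLp 2 fun _ => 1 / 2, fun _ => rfl⟩
  obtain ⟨w, hw⟩ : ∃ w : ℕ → UnitAddTorus (Fin 3) → EuclideanSpace ℝ (Fin 3),
      ∀ n, w n = Torus.periodize fun y => (8 * n : ℝ) • U ((8 * n : ℝ) • (y + -q)) :=
    ⟨_, fun n => rfl⟩
  -- the fixed numbers of the seed
  set σU := ∫ z, ⟪fderiv ℝ U z (U z), Δ U z⟫ with hσU
  set KU := ∫ z, ‖U z‖ ^ 2 with hKU
  set GU := ∫ z, ∑ i, ‖fderiv ℝ U z (EuclideanSpace.single i 1)‖ ^ 2 with hGU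
  set DU := ∫ z, ‖Δ U z‖ ^ 2 with hDU
  have hKU0 : 0 ≤ KU := integral_nonneg fun _ => sq_nonneg _
  have hGU0 : 0 ≤ GU := integral_nonneg fun _ => Finset.sum_nonneg fun _ _ => sq_nonneg _
  have hDU0 : 0 ≤ DU := integral_nonneg fun _ => sq_nonneg _
  -- amplitude `t₀` with `t₀ σ(U) − D(U) = 1`
  set t₀ : ℝ := (DU + 1) / σU with ht₀
  have ht₀pos : 0 < t₀ := by positivity
  have ht₀σ : t₀ * σU - DU = 1 := by
    rw [ht₀, div_mul_cancel₀ _ hσ.ne']; ring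
  -- the constant `M`
  set M : ℝ := Cν 1 * (t₀ ^ 2 * (2⁻¹ * KU)) ^ a * (t₀ ^ 2 * (2⁻¹ * GU)) ^ b * (t₀ ^ 2 * DU) ^ e
    with hM
  -- the key inequality along the family
  have key : ∀ n : ℕ, 1 ≤ n →
      t₀ ^ 2 * 8 ^ (3 : ℝ) * (n : ℝ) ^ (3 : ℝ) ≤
        M * (8 : ℝ) ^ (b - a + 3 * e) * (n : ℝ) ^ (b - a + 3 * e) := by
    intro n hn
    have hn' : (1 : ℝ) ≤ n := by exact_mod_cast hn
    have hc8 : (8 : ℝ) ≤ 8 * n := by linarith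
    have hc0 : (0 : ℝ) < 8 * n := by linarith
    obtain ⟨hsm, hdf, hzm, hσn, hEn, hDn⟩ := planted_facts hU hUs hdiv hq hc8
    have hKn := planted_kineticEnergy hUs hq hc8
    rw [← hw n] at hsm hdf hzm hσn hEn hDn hKn
    have hray := rate_ray_le_budget hB (by simp) hsm hdf hzm t₀
    -- left side: `t₀³ c³ σU − t₀² c³ DU = t₀² c³`
    have hL : t₀ ^ 3 * enstrophyProduction (w n) - t₀ ^ 2 * (∫ x, ‖Torus.laplacian (w n) x‖ ^ 2) =
        t₀ ^ 2 * (8 * n : ℝ) ^ 3 := by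
      rw [hσn, hDn]
      have : t₀ ^ 3 * ((8 * n : ℝ) ^ 3 * σU) - t₀ ^ 2 * ((8 * n : ℝ) ^ 3 * DU) =
          t₀ ^ 2 * (8 * n : ℝ) ^ 3 * (t₀ * σU - DU) := by ring
      rw [this, ht₀σ, mul_one]
    -- right side: the budget at `t₀ • w n` is `M c^{b - a + 3e}`
    have hR : Cν 1 * Torus.kineticEnergy (t₀ • w n) ^ a * torusEnstrophy (t₀ • w n) ^ b *
        (∫ x, ‖Torus.laplacian (t₀ • w n) x‖ ^ 2) ^ e = M * (8 * n : ℝ) ^ (b - a + 3 * e) := by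
      have hw1 : Torus.IsContDiff 1 (w n) := hsm.isContDiff (n := 1) (WithTop.coe_le_coe.mpr le_top)
      rw [kineticEnergy_const_smul, torusEnstrophy_const_smul hw1, laplacianNormSq_const_smul hsm,
        hKn, hEn, hDn]
      -- isolate the powers of `c = 8n`
      have e1 : (t₀ ^ 2 * (2⁻¹ * ((8 * n : ℝ)⁻¹ * KU))) ^ a =
          (t₀ ^ 2 * (2⁻¹ * KU)) ^ a * (8 * n : ℝ) ^ (-a) := by
        rw [show t₀ ^ 2 * (2⁻¹ * ((8 * n : ℝ)⁻¹ * KU)) = (t₀ ^ 2 * (2⁻¹ * KU)) * (8 * n : ℝ)⁻¹ by ring,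
          Real.mul_rpow (by positivity) (by positivity), Real.inv_rpow hc0.le, Real.rpow_neg hc0.le]
      have e2 : (t₀ ^ 2 * (2⁻¹ * ((8 * n : ℝ) * GU))) ^ b =
          (t₀ ^ 2 * (2⁻¹ * GU)) ^ b * (8 * n : ℝ) ^ b := by
        rw [show t₀ ^ 2 * (2⁻¹ * ((8 * n : ℝ) * GU)) = (t₀ ^ 2 * (2⁻¹ * GU)) * (8 * n : ℝ) by ring,
          Real.mul_rpow (by positivity) hc0.le]
      have e3 : (t₀ ^ 2 * ((8 * n : ℝ) ^ 3 * DU)) ^ e =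
          (t₀ ^ 2 * DU) ^ e * (8 * n : ℝ) ^ (3 * e) := by
        rw [show t₀ ^ 2 * ((8 * n : ℝ) ^ 3 * DU) = (t₀ ^ 2 * DU) * (8 * n : ℝ) ^ 3 by ring,
          Real.mul_rpow (by positivity) (by positivity), ← Real.rpow_natCast (8 * n : ℝ) 3,
          ← Real.rpow_mul hc0.le]
        norm_num
      have e4 : (8 * n : ℝ) ^ (-a) * (8 * n : ℝ) ^ b * (8 * n : ℝ) ^ (3 * e) =
          (8 * n : ℝ) ^ (b - a + 3 * e) := by
        rw [← Real.rpow_add hc0, ← Real.rpow_add hc0]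
        congr 1
        ring
      rw [e1, e2, e3, hM, ← e4]
      ring
    have hineq : t₀ ^ 2 * (8 * n : ℝ) ^ 3 ≤ M * (8 * n : ℝ) ^ (b - a + 3 * e) := by
      rw [← hL, ← hR]; exact hray
    -- split `(8n)^r = 8^r n^r`
    have h83 : (8 * n : ℝ) ^ 3 = (8 : ℝ) ^ (3 : ℝ) * (n : ℝ) ^ (3 : ℝ) := by
      rw [← Real.rpow_natCast (8 * n : ℝ) 3, Nat.cast_ofNat,
        Real.mul_rpow (by norm_num) (by positivity)]
    have h8r : (8 * n : ℝ) ^ (b - a + 3 * e) = (8 : ℝ) ^ (b - a + 3 * e) * (n : ℝ) ^ (b - a + 3 * e) :=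
      Real.mul_rpow (by norm_num) (by positivity)
    rw [h83, h8r, ← mul_assoc, ← mul_assoc] at hineq
    exact hineq
  have h3 := exponent_le_of_forall_nat_mul_rpow_le (by positivity) key
  linarith

/-- **The `K^a ℰ^b` sub-class** (`e = 0`): for `b − a < 3` and every `C(ν)`, the budget
`dℰ/dt ≤ C(ν) K^a ℰ^b` fails on `T³`. Row C1 of the census is `(a, b) = (0, 2)`
(`not_enstrophyQuadraticBudget`); the Grönwall-closable shape `ℰ · g` with `∫g dt` bounded in the
energy class has degree `s_g + 1 = 2 < 3`. [folklore] -/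
theorem not_isRateBudget_torusEnstrophy_monomial_KE (a b : ℝ) (hab : b - a < 3) (Cν : ℝ → ℝ) :
    ¬ IsRateBudget (d := Fin 3) torusEnstrophy (fun ν v =>
      Cν ν * Torus.kineticEnergy v ^ a * torusEnstrophy v ^ b) := by
  intro hB
  refine not_isRateBudget_torusEnstrophy_monomial a b 0 (by linarith) Cν (hB.mono fun ν _ v => ?_)
  rw [Real.rpow_zero, mul_one]

end Summit.NavierStokesRegularity.FunctionalMining

end
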